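import Literature.AlgebraicGeometry.Motives.ProetLimOneSequence
import Literature.AlgebraicGeometry.Motives.ConstantEtaleSheaf
import HarnessLib

/-!
# Finiteness of `ℓ`-adic cohomology, VII: Milne V Lemma 1.11 and the finiteness facts from the
# exactness of countable products on `Y_proét`

Assembly of Parts III (`EllAdicCohomologyFinitenessProofs.lean`: the coefficient sequence, the
algebraic core of Milne V.1.11, degree `0`) and VI (`ProetLimOneSequence.lean`: the pro-étale `lim¹`
sequence modulo the named fact `bijective_piComparison_proetCohomology`, Bhatt–Scholze Prop. 3.1.9).
Everything here is a proved implication between named facts of the `ℓ`-adic finiteness cluster: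

* `ProetCohomology.eq_zero_of_forall_pow_smul_succ_of_piComparison` — separatedness of
  `Hⁱ⁺¹_proét(Y, ℤ_ℓ)` when the `Hⁱ(Y_proét, ℤ/ℓᵐ)` are finite (`lim¹ = 0` by Mittag-Leffler and the
  injectivity of `ρ`);
* `module_finite_proetCohomology_padicInt_of_piComparison` — **Milne V Lemma 1.11 for the canonical
  `ℤ_ℓ`-module structure of `Hⁱ_proét(Y, ℤ_ℓ)`** from `bijective_piComparison_proetCohomology` and the
  finiteness of all `Hʲ(Y_proét, ℤ/ℓᵐ)`;
* `exists_module_finite_ellAdicCohomology_of_finite_of_piComparison` — the Part I fact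
  `exists_module_finite_ellAdicCohomology_of_finite` (V.1.11 + BS 5.6.2) from
  `bijective_piComparison_proetCohomology` ALONE;
* `exists_module_finite_ellAdicCohomology_of_isProper_of_finite_of_piComparison`,
  `module_finite_proetCohomology_padicInt_of_isProper_of_piComparison`,
  `exists_addEquiv_geometricEllAdicCohomology_of_finite_of_piComparison` — finite generation of
  `Hⁱ_proét(Y, ℤ_ℓ)` over `ℤ_ℓ` for `Y` proper over a separably closed field (some module structure;
  also canonically; Milne V.1.11 with VI.2.8 — a composite, stated as an explicit conclusion, not a
  named fact, D-0026) and the fact `exists_addEquiv_geometricEllAdicCohomology k`, from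
  {`finite_proetCohomology_zmod_of_isProper`, `bijective_piComparison_proetCohomology`};
* `exists_module_finite_ellAdicCohomology_of_isProper_of_constantSheaf_of_piComparison` — hence from
  {Milne VI Cor. 2.8 = `finite_etaleCohomology_of_isProper`, Bhatt–Scholze Cor. 5.1.9 on constant
  sheaves (`Hⁱ(X_proét, M_X) ≅ Hⁱ(X_ét, M_X)`, an explicit hypothesis — it is Cor. 5.1.6 specialised,
  not a separate named fact, D-0026; supplied from Cor. 5.1.6 by
  `nonempty_addEquiv_constantSheafH_proet_etale_of_pullback`, `EtaleToProet.lean`), Bhatt–Scholze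
  Prop. 3.1.9 = `bijective_piComparison_proetCohomology`}: compared with the base {VI.2.8, BS 5.6.2 =
  `ellAdicCohomology_limOneSequence`} of `EllAdicCohomologyModuleFiniteness.lean`, the comparison
  theorem 5.6.2 (with Jannsen's continuous cohomology, `R lim`, and the naturality of `ν*` in the
  tower) is traded for the bridge on constant coefficients (no naturality) and a structural
  property of the pro-étale topos.

## References

* J. S. Milne, *Étale cohomology* (2025 reissue, held copy; PDF pages): V Lemma 1.11 pp. 177–178;
  VI Cor. 2.8 p. 238. [Milne2025]
* B. Bhatt, P. Scholze, *The pro-étale topology for schemes*, Astérisque 369 (2015) (held: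
  arXiv:1309.1198): Prop. 3.1.9, Cor. 5.1.6/5.1.9, Prop. 5.6.2. [BhattScholze2015]
-/

universe u

open CategoryTheory AlgebraicGeometry

noncomputable section

namespace Literature.AlgebraicGeometry.Motives

/-! ### Consequences -/

section Consequences

variable (Y : Scheme.{u}) (ℓ : ℕ) [Fact ℓ.Prime]

/-- **Separatedness of `Hⁱ⁺¹_proét(Y, ℤ_ℓ)`** from the pro-étale `lim¹` sequence: if all
`Hⁱ(Y_proét, ℤ/ℓᵐ)` are finite, then `lim¹ = 0` (Mittag-Leffler, `subsingleton_towerLimOne_of_finite`),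
`ρ` is injective, and it kills every class divisible by all `ℓᵐ` (its components are the
reductions, `ProetCohomology.map_reductionHom_pow_smul`). Milne, proof of V.1.11 (p. 178): "no
non-zero element of it is divisible by all powers of `l`". [cite: Milne2025, V Lemma 1.11 (proof, p. 178)] -/
theorem ProetCohomology.eq_zero_of_forall_pow_smul_succ_of_piComparison
    (hpi : bijective_piComparison_proetCohomology.{u}) (i : ℕ)
    (hfin : ∀ m, Finite (ProetCohomology Y (ZMod (ℓ ^ m)) i)) (z : ProetCohomology Y ℤ_[ℓ] (i + 1))
    (hz : ∀ m : ℕ, ∃ y : ProetCohomology Y ℤ_[ℓ] (i + 1), ((ℓ : ℤ_[ℓ]) ^ m) • y = z) : z = 0 := by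
  obtain ⟨δ, -, -, hrange⟩ := proetCohomology_limOneSequence_of_piComparison Y ℓ hpi i
  haveI : ∀ m, Finite (proetCohomologyZModPow Y ℓ i m) := hfin
  haveI := subsingleton_towerLimOne_of_finite (proetCohomologyZModPowMap Y ℓ i)
  have hρ : ProetCohomology.toTowerLim Y ℓ (i + 1) z = 0 := by
    refine Subtype.ext (funext fun m => ?_)
    rw [ZeroMemClass.coe_zero, Pi.zero_apply, ProetCohomology.coe_toTowerLim_apply]
    obtain ⟨y, rfl⟩ := hz m
    exact ProetCohomology.map_reductionHom_pow_smul Y ℓ m (i + 1) y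
  have hz' : z ∈ (ProetCohomology.toTowerLim Y ℓ (i + 1)).ker := (AddMonoidHom.mem_ker).2 hρ
  rw [← hrange] at hz'
  obtain ⟨l, rfl⟩ := hz'
  rw [Subsingleton.elim l 0, map_zero]

/-- **Milne V Lemma 1.11 for `Hⁱ_proét(Y, ℤ_ℓ)` modulo the product comparison alone**: if all
`Hʲ(Y_proét, ℤ/ℓᵐ)` are finite, every `Hⁱ_proét(Y, ℤ_ℓ)` is a finitely generated `ℤ_ℓ`-module for
its canonical structure (Part III: algebraic core, degree `0`; separatedness above in degrees
`j + 1`). [cite: Milne2025, V Lemma 1.11] -/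
theorem module_finite_proetCohomology_padicInt_of_piComparison
    (hpi : bijective_piComparison_proetCohomology.{u})
    (hfin : ∀ m j : ℕ, Finite (ProetCohomology Y (ZMod (ℓ ^ m)) j)) (i : ℕ) :
    Module.Finite ℤ_[ℓ] (ProetCohomology Y ℤ_[ℓ] i) := by
  cases i with
  | zero => exact ProetCohomology.module_finite_zero_of_finite Y ℓ (hfin 1 0)
  | succ j =>
    exact ProetCohomology.module_finite_of_finite_of_separated Y ℓ (j + 1) (hfin 1 (j + 1))
      fun z hz => ProetCohomology.eq_zero_of_forall_pow_smul_succ_of_piComparison Y ℓ hpi j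
        (fun m => hfin m j) z hz

/-- **The Part I fact `exists_module_finite_ellAdicCohomology_of_finite` (Milne V.1.11 +
Bhatt–Scholze 5.6.2) follows from `bijective_piComparison_proetCohomology` ALONE** (Milne V.1.11,
the coefficient sequences and the `lim¹` bookkeeping being proved). [cite: Milne2025, V Lemma 1.11]
[cite: BhattScholze2015, Prop. 5.6.2] -/
theorem exists_module_finite_ellAdicCohomology_of_finite_of_piComparison
    (hpi : bijective_piComparison_proetCohomology.{u}) :
    exists_module_finite_ellAdicCohomology_of_finite.{u} := by
  intro Y _ ℓ _ hfin i
  exact ⟨ellAdicCohomologyModule Y ℓ i,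
    module_finite_proetCohomology_padicInt_of_piComparison Y ℓ hpi hfin i⟩

/-- **`Hⁱ_proét(Y, ℤ_ℓ)` is a finitely generated `ℤ_ℓ`-module for `Y` proper over a separably closed
field (Milne V Lemma 1.11 with VI Cor. 2.8), from the pro-étale finiteness fact
`finite_proetCohomology_zmod_of_isProper` (Milne VI Cor. 2.8 on `Y_proét`) and
`bijective_piComparison_proetCohomology`** — an alternative to the trust base {Milne VI Cor. 2.8
on `Y_ét`, Bhatt–Scholze Prop. 5.6.2} of `EllAdicCohomologyModuleFiniteness.lean`. The conclusion
(a `ℤ_ℓ`-module structure on Mathlib's group `Scheme.EllAdicCohomology Y ℓ i` for which it is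
finitely generated) is spelled out: it is a composite of printed theorems, not a named fact (D-0026).
[cite: Milne2025, V Lemma 1.11 and VI Cor. 2.8] -/
theorem exists_module_finite_ellAdicCohomology_of_isProper_of_finite_of_piComparison
    (hB : finite_proetCohomology_zmod_of_isProper.{u})
    (hpi : bijective_piComparison_proetCohomology.{u}) :
    ∀ ⦃K : Type u⦄ [Field K] [IsSepClosed K] ⦃Y : Scheme.{u}⦄ (f : Y ⟶ Spec (CommRingCat.of K))
      [IsProper f] (ℓ : ℕ) [Fact ℓ.Prime] (i : ℕ),
      ∃ _ : Module ℤ_[ℓ] (Y.EllAdicCohomology ℓ i), Module.Finite ℤ_[ℓ] (Y.EllAdicCohomology ℓ i) :=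
  exists_module_finite_ellAdicCohomology_of_isProper_of_facts hB
    (exists_module_finite_ellAdicCohomology_of_finite_of_piComparison hpi)

/-- The same for the canonical `ℤ_ℓ`-module structure: for `Y` proper over a separably closed
field, every `Hⁱ_proét(Y, ℤ_ℓ)` is finitely generated for the structure of
`ProetCohomologyModule.lean`, from `finite_proetCohomology_zmod_of_isProper` and
`bijective_piComparison_proetCohomology`. [cite: Milne2025, V Lemma 1.11 and VI Cor. 2.8] -/
theorem module_finite_proetCohomology_padicInt_of_isProper_of_piComparison
    (hB : finite_proetCohomology_zmod_of_isProper.{u})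
    (hpi : bijective_piComparison_proetCohomology.{u}) {K : Type u} [Field K] [IsSepClosed K]
    {Y : Scheme.{u}} (f : Y ⟶ Spec (CommRingCat.of K)) [IsProper f] (ℓ : ℕ) [Fact ℓ.Prime]
    (i : ℕ) : Module.Finite ℤ_[ℓ] (ProetCohomology Y ℤ_[ℓ] i) :=
  module_finite_proetCohomology_padicInt_of_piComparison Y ℓ hpi (fun m j =>
    haveI : NeZero (ℓ ^ m) := ⟨pow_ne_zero m (Fact.out : ℓ.Prime).ne_zero⟩
    hB f (ℓ ^ m) j) i

/-- **`exists_addEquiv_geometricEllAdicCohomology k` (`Hⁱ_proét(X_{k̄}, ℤ_ℓ) ≃+ ℤ_ℓ^b × finite`) from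
`finite_proetCohomology_zmod_of_isProper` and `bijective_piComparison_proetCohomology`**, via
the Part I reduction `exists_addEquiv_geometricEllAdicCohomology_of_module_finite`.
[cite: Milne2025, V Lemma 1.11 and VI Cor. 2.8] -/
theorem exists_addEquiv_geometricEllAdicCohomology_of_finite_of_piComparison
    (hB : finite_proetCohomology_zmod_of_isProper.{u})
    (hpi : bijective_piComparison_proetCohomology.{u}) (k : Type u) [Field k] :
    exists_addEquiv_geometricEllAdicCohomology k :=
  exists_addEquiv_geometricEllAdicCohomology_of_module_finite k
    (exists_module_finite_ellAdicCohomology_of_isProper_of_finite_of_piComparison hB hpi)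

/-- The same module-level finiteness of `Hⁱ_proét(Y, ℤ_ℓ)`, `Y` proper over a separably closed
field, from Milne VI Cor. 2.8 on the étale site (`finite_etaleCohomology_of_isProper`), the
constant-sheaf comparison of Bhatt–Scholze Cor. 5.1.9 / 5.1.6 — `Hⁱ(Y_proét, M_Y) ≅ Hⁱ(Y_ét, M_Y)` for
all schemes `Y`, abelian groups `M` and `i`, taken as the explicit hypothesis `h` (it is Cor. 5.1.6
specialised to constant sheaves, not a separate named fact, D-0026; it follows from Cor. 5.1.6 as
printed by `nonempty_addEquiv_constantSheafH_proet_etale_of_pullback`, `EtaleToProet.lean`) — and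
`bijective_piComparison_proetCohomology`. The bridge `Hⁱ(Y_proét, F_{ℤ/n}) ≅ Hⁱ(Y_ét, ℤ/n)` is `h` at
`M = ℤ/n` composed with the proved Lemma 4.2.12 transport `proetCohomologyEquivConstantSheafH`.
[cite: Milne2025, VI Cor. 2.8] [cite: BhattScholze2015, Cor. 5.1.9 and Prop. 3.1.9] -/
theorem exists_module_finite_ellAdicCohomology_of_isProper_of_constantSheaf_of_piComparison
    (h₂ : finite_etaleCohomology_of_isProper.{u})
    (h : ∀ (X : Scheme.{u}) (M : Type) [AddCommGroup M] (i : ℕ),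
      Nonempty
        (((constantSheaf (Scheme.ProEt.topology X) Ab.{u + 1}).obj
            (AddCommGrpCat.of (ULift.{u + 1} M))).H i ≃+
          (((constantSheaf X.smallEtaleTopology Ab.{u}).obj (AddCommGrpCat.of (ULift.{u} M))).H i :
            Type u)))
    (hpi : bijective_piComparison_proetCohomology.{u}) :
    ∀ ⦃K : Type u⦄ [Field K] [IsSepClosed K] ⦃Y : Scheme.{u}⦄ (f : Y ⟶ Spec (CommRingCat.of K))
      [IsProper f] (ℓ : ℕ) [Fact ℓ.Prime] (i : ℕ),
      ∃ _ : Module ℤ_[ℓ] (Y.EllAdicCohomology ℓ i), Module.Finite ℤ_[ℓ] (Y.EllAdicCohomology ℓ i) :=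
  exists_module_finite_ellAdicCohomology_of_isProper_of_finite_of_piComparison
    (finite_proetCohomology_zmod_of_isProper_of_etale_facts h₂ fun X n i => by
      obtain ⟨e⟩ := h X (ZMod n) i
      exact ⟨(proetCohomologyEquivConstantSheafH X (ZMod n) i).trans e⟩) hpi

end Consequences

end Literature.AlgebraicGeometry.Motives

end
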